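import Summits.BirchSwinnertonDyer.BirchSwinnertonDyer.Theorems.PrintX9MuPartOfPrintKSOfHowardIntended
import Summits.BirchSwinnertonDyer.BirchSwinnertonDyer.Theorems.PoitouTateSelmerStructureDualityConjHolds
import Literature.NumberTheory.GaloisCohomology.Howard2004.EngineDecompositionsOfSkewPairingIntendedProofs
import Summits.BirchSwinnertonDyer.BirchSwinnertonDyer.Theses.PrintX9
import Summits.BirchSwinnertonDyer.BirchSwinnertonDyer.Theses.PrintX10b
import HarnessLib

/-!
# Line `flach_byname` on the shared μ-crux `MuInequalityCoherentPair` (stmt-BirchSwinnertonDyer-22642) —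
# RESHAPED CUT v5: TWO STUBS = Howard Prop. 1.4.1 / Flach PRINT-AS-INTENDED (C45.1″) and CGLS Thm. 4.1.1 (F-411) BY NAME (x9-p1 LEAD g10, 2026-08-29)

Supersedes v4 `leaves_byname` (same seat, 08:46Z; stubs `stub_h161` = Howard Thm. 1.6.1 print-as-WORDED, `stub_h411`). Since then the
cell's G87 ENGINE closed: `HowardThm161PrintIntended.thm161_printIntended_of_prop141[_printIntended] (h141) : thm161_dvrKolyvaginBound_printIntended` (x10b-p1-w2
g17 p720105 / w7 g12 CLOSING″ + Summits twins) — Howard 2004 Thm. 1.6.1 PRINT-AS-INTENDED is a KERNEL theorem modulo the ONE cite-only leaf C45.1″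
`Howard2004.prop141_casselsTate_skewPairing_atLevel_printIntended` (Howard Prop. 1.4.1 + Thm. 1.4.2 displays, print-as-intended; Flach 1990; CLOSING″ w7 g12) and the tree's Poitou–Tate
theorem — and this seat re-derived the μ-road against the intended leaf (`HeegnerMuPartOfHowardIntended.muPartStabilizedCoherentPair_of_howardIntended_thm411
: F-161′ → F-411 → L∃`, p711800). So the honest registry now reads: «22642 closes modulo EXACTLY the two cite-only print leaves C45.1″ (Howard
Prop. 1.4.1 / Flach, as intended) and F-411 (CGLS 2022 Thm. 4.1.1 KS form)» — the Howard input SHRINKS from Thm. 1.6.1 (as worded, stronger than print's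
proof) to Prop. 1.4.1 (a published theorem Howard imports). `stub_h411` keeps its v4 name and signature; `stub_h141` replaces `stub_h161`.
Composition concludes the letter AND both route decls BY NAME; `sorry` only inside `stub_*`. No summit statement is proved; Howard Thm. 1.6.1
as worded (F-161) is NOT proved; BSD is NOT proved by any of this.
-/

set_option linter.dupNamespace false
set_option autoImplicit false

namespace Summit.BirchSwinnertonDyer.BirchSwinnertonDyer.Cruxes.MuInequalityCoherentPair.FlachByName

open Summit.BirchSwinnertonDyer.BirchSwinnertonDyer.Theorems
open Literature.NumberTheory.GaloisCohomology.Howard2004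

/-! ## The two stubs (the ONLY sorries of the file) — cite-only print leaves BY NAME -/

/-- Stub `stub_h141` — the CITE-ONLY print leaf Howard 2004 Prop. 1.4.1 with the displays of Thm. 1.4.2 (`(k,n)`-version) PRINT-AS-INTENDED,
after Flach 1990 (`Howard2004.prop141_casselsTate_skewPairing_atLevel_printIntended`, C45.1″ = C45.1′ + the two guards of F-161′, REF-177, lit g46 p722866). Closes only if the leaf becomes a kernel theorem (cochain-level
generalised Cassels–Tate pairing: C¹/C² lifts, local `β′_v`, `Σ inv_v = 0`, skew-symmetry; XL — the cell's C451-* bricks are its first steps).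
Not worker-sized. [cite: Howard2004HeegnerKolyvagin, Prop. 1.4.1 and Thm. 1.4.2 (arXiv:1202.6340 §2.4)] [cite: Flach1990] -/
theorem stub_h141 :
    Literature.NumberTheory.GaloisCohomology.Howard2004.prop141_casselsTate_skewPairing_atLevel_printIntended := by
  sorry

/-- Stub `stub_h411` — the CITE-ONLY print leaf CGLS 2022 Thm. 4.1.1 in Kolyvagin-system form with Rem. 4.1.4
(`CastellaGrossiLeeSkinner2022.thm411_exists_kolyvaginSystem_one_ne_zero`, F-411); name and signature identical to v4. Not worker-sized (XL).
[cite: CastellaGrossiLeeSkinner2022, Thm. 4.1.1, Rem. 4.1.4 (arXiv:2008.02571 §4.1)] -/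
theorem stub_h411 :
    Literature.NumberTheory.EllipticCurves.CastellaGrossiLeeSkinner2022.thm411_exists_kolyvaginSystem_one_ne_zero := by
  sorry

/-! ## Composition (kernel-checked, no `sorry` outside the stubs) -/

/-- **ROW 9 — the crux decl BY NAME from the two stubs**: `Theses.PrintX9.MuInequalityCoherentPair` (stmt-BirchSwinnertonDyer-22642) :=
the μ-road at the print-as-intended Howard leaf (`HeegnerMuPartOfHowardIntended.muPartStabilizedCoherentPair_of_howardIntended_thm411`, p711800)
fed with the engine's CLOSING″ `DVRSetting.thm161_printIntended_of_prop141_printIntended` (p723075) at `stub_h141`, its Poitou–Tate binder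
discharged by the tree (`InputsPoitouTateSelmer.poitouTate_selmerStructure_duality_conj_holds`), and `stub_h411`. -/
theorem MuInequalityCoherentPair_of_stubs :
    Summit.BirchSwinnertonDyer.BirchSwinnertonDyer.Theses.PrintX9.MuInequalityCoherentPair :=
  HeegnerMuPartOfHowardIntended.muPartStabilizedCoherentPair_of_howardIntended_thm411
    (DVRSetting.thm161_printIntended_of_prop141_printIntended stub_h141 fun K _ _ =>
      InputsPoitouTateSelmer.poitouTate_selmerStructure_duality_conj_holds K)
    stub_h411

/-- **ROW 10 twin — the same item over `Theses.PrintX10b` from the two stubs** (identical text). -/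
theorem MuInequalityCoherentPair_of_stubs_X10b :
    Summit.BirchSwinnertonDyer.BirchSwinnertonDyer.Theses.PrintX10b.MuInequalityCoherentPair :=
  MuInequalityCoherentPair_of_stubs

/-- The crux letter L∃ (`HeegnerMuPartStabilized.MuPartStabilizedCoherentPair`, Theorems-side text of the item) from the two stubs. -/
theorem MuPartStabilizedCoherentPair_of_stubs : HeegnerMuPartStabilized.MuPartStabilizedCoherentPair :=
  MuInequalityCoherentPair_of_stubs

end Summit.BirchSwinnertonDyer.BirchSwinnertonDyer.Cruxes.MuInequalityCoherentPair.FlachByName
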